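import Literature.NumberTheory.EllipticCurves.PadicSigmaSq
import Literature.NumberTheory.EllipticCurves.PadicSigmaSqDivisionTwo
import Literature.NumberTheory.EllipticCurves.ManinConstantQuadraticTwistAtTwoOrdinaryProofs
import Literature.NumberTheory.EllipticCurves.NoEverywhereGoodReductionRat

/-!
# §57 (seat `bsd-f1-sign2-an`, g53) — the unit-root / Mazur–Tate constant at a good ORDINARY prime `2`
# in closed form: digit laws and the Koblitz–Katz–MST series (typed candidate `Prop`s; nothing asserted)

`c` below is the constant of a Mazur–Tate sigma-SQUARED pair of `W ⊗ ℚ₂`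
(`WeierstrassCurve.IsMazurTateSigmaSqPair`, = PARI's `ellpadics2`, = `(b₂ − E₂(E,ω))/12` with `E₂` the value
of Katz's `2`-adic weight-2 Eisenstein series).  Write `E₂ := b₂ − 12c`.

* `UnitRootParityLawAtTwo`      : `c ≡ a₃·a₁⁻¹ (mod 2)`            (t²-coefficient of Katz's unit-root criterion);
* `UnitRootTraceLawAtTwo`       : `E₂ ≡ 3 + 2·a₂(E) (mod 8)`        (first digit = Frobenius trace);
* `E2CongruenceC6C4AtTwo`       : `E₂·c₄ + c₆ ≡ 0 (mod 16)`, valuation EXACTLY 4 (`…Exact`);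
* `KoblitzKatzTruncationAtTwo k`: `E₂·c₄^{3K−2} + c₆·Σ_{n<K} c(n) Δⁿ c₄^{3(K−1−n)} ≡ 0 (mod 2^{k+4})`, `K = 2^k`,
  `c(n)` = the `1/j`-expansion coefficients of `P·Q/R` (`1, 720, 911520, 1301011200, …`; Koblitz 1977:
  `ord₂ c(n) = ℓ₂(n) + 3 s₂(n)`; Mazur–Stein–Tate 2006 Thm. 6.3), typed for `k = 1, 2`.
Census (BC5 witness): `Cruxes/RankOneAtTwoBigImageOddLocal/CensusAN61.md`.
-/

namespace Summit.BirchSwinnertonDyer.BirchSwinnertonDyer.Cruxes.RankOneAtTwoBigImageOddLocal.AN57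

open WeierstrassCurve

/-- `E₂(W, c) := b₂(W ⊗ ℚ₂) − 12·c` — the value of Katz's weight-2 Eisenstein series attached to a
Mazur–Tate constant `c` (MST 2006 (1.1): `c = (a₁² + 4a₂ − E₂(E,ω))/12`). -/
noncomputable def eTwo (W : WeierstrassCurve ℚ) (c : ℚ_[2]) : ℚ_[2] :=
  (W.baseChange ℚ_[2]).b₂ - 12 * c

/-- P57-parity: the canonical constant is `≡ a₃/a₁ (mod 2)` on a globally minimal model, good ordinary at `2`. -/
def UnitRootParityLawAtTwo : Prop :=
  ∀ (W : WeierstrassCurve ℚ) [W.IsElliptic] [W.IsGloballyMinimal],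
    W.HasGoodReductionAtPrime 2 → ¬ (2 : ℤ) ∣ W.frobeniusTrace 2 →
    ∀ (Sq : PowerSeries ℚ_[2]) (c : ℚ_[2]), (W.baseChange ℚ_[2]).IsMazurTateSigmaSqPair Sq c →
      ‖c - (W.baseChange ℚ_[2]).a₃ * ((W.baseChange ℚ_[2]).a₁)⁻¹‖ ≤ 2⁻¹

/-- P57a: FIRST DIGIT = FROBENIUS TRACE: `E₂ ≡ 3 + 2·a₂(E) (mod 8)`. -/
def UnitRootTraceLawAtTwo : Prop :=
  ∀ (W : WeierstrassCurve ℚ) [W.IsElliptic] [W.IsGloballyMinimal],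
    W.HasGoodReductionAtPrime 2 → ¬ (2 : ℤ) ∣ W.frobeniusTrace 2 →
    ∀ (Sq : PowerSeries ℚ_[2]) (c : ℚ_[2]), (W.baseChange ℚ_[2]).IsMazurTateSigmaSqPair Sq c →
      ‖eTwo W c - (3 + 2 * (W.frobeniusTrace 2 : ℚ_[2]))‖ ≤ 2⁻¹ ^ 3

/-- P57b: `E₂ ≡ −c₆/c₄ (mod 16)`, i.e. `‖E₂·c₄ + c₆‖ ≤ 2⁻⁴` (`c₄`, `c₆` are `2`-adic units here). -/
def E2CongruenceC6C4AtTwo : Prop :=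
  ∀ (W : WeierstrassCurve ℚ) [W.IsElliptic] [W.IsGloballyMinimal],
    W.HasGoodReductionAtPrime 2 → ¬ (2 : ℤ) ∣ W.frobeniusTrace 2 →
    ∀ (Sq : PowerSeries ℚ_[2]) (c : ℚ_[2]), (W.baseChange ℚ_[2]).IsMazurTateSigmaSqPair Sq c →
      ‖eTwo W c * (W.baseChange ℚ_[2]).c₄ + (W.baseChange ℚ_[2]).c₆‖ ≤ 2⁻¹ ^ 4

/-- P57b-exact: the valuation of `E₂·c₄ + c₆` is EXACTLY `4` (tail of the Koblitz series ≡ `c(1)/j ≡ 16 (mod 32)`). -/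
def E2CongruenceC6C4AtTwoExact : Prop :=
  ∀ (W : WeierstrassCurve ℚ) [W.IsElliptic] [W.IsGloballyMinimal],
    W.HasGoodReductionAtPrime 2 → ¬ (2 : ℤ) ∣ W.frobeniusTrace 2 →
    ∀ (Sq : PowerSeries ℚ_[2]) (c : ℚ_[2]), (W.baseChange ℚ_[2]).IsMazurTateSigmaSqPair Sq c →
      ‖eTwo W c * (W.baseChange ℚ_[2]).c₄ + (W.baseChange ℚ_[2]).c₆‖ = 2⁻¹ ^ 4

/-- The first Koblitz coefficients `c(n)`, `n < 4`, of `P·Q/R = Σ c(n) j⁻ⁿ` (q-reversion; Koblitz 1977). -/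
def koblitzCoeff : Fin 4 → ℤ := ![1, 720, 911520, 1301011200]

/-- P57c(k): truncating the Koblitz–Katz series after `K = 2^k` terms leaves an error of valuation `≥ k+4`
(in fact `= k+4`): `‖E₂·c₄^{3K−2} + c₆·Σ_{n<K} c(n)·Δⁿ·c₄^{3(K−1−n)}‖ ≤ 2^{−(k+4)}`; typed for `k ≤ 2`. -/
def KoblitzKatzTruncationAtTwo (k : Fin 3) : Prop :=
  ∀ (W : WeierstrassCurve ℚ) [W.IsElliptic] [W.IsGloballyMinimal],
    W.HasGoodReductionAtPrime 2 → ¬ (2 : ℤ) ∣ W.frobeniusTrace 2 →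
    ∀ (Sq : PowerSeries ℚ_[2]) (c : ℚ_[2]), (W.baseChange ℚ_[2]).IsMazurTateSigmaSqPair Sq c →
      ‖eTwo W c * (W.baseChange ℚ_[2]).c₄ ^ (3 * 2 ^ (k : ℕ) - 2)
          + (W.baseChange ℚ_[2]).c₆ *
            ∑ n ∈ Finset.range (2 ^ (k : ℕ)),
              (koblitzCoeff ⟨n % 4, Nat.mod_lt n (by norm_num)⟩ : ℚ_[2]) * (W.baseChange ℚ_[2]).Δ ^ n
                * (W.baseChange ℚ_[2]).c₄ ^ (3 * (2 ^ (k : ℕ) - 1 - n))‖ ≤ 2⁻¹ ^ ((k : ℕ) + 4)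

/-- Sanity: `k = 0` of the truncation schema is literally P57b (one term, `c(0) = 1`). -/
example : KoblitzKatzTruncationAtTwo 0 → E2CongruenceC6C4AtTwo := by
  intro h W _ _ hg ho Sq c hp
  simpa [koblitzCoeff, eTwo] using h W hg ho Sq c hp

end Summit.BirchSwinnertonDyer.BirchSwinnertonDyer.Cruxes.RankOneAtTwoBigImageOddLocal.AN57

/-! ## Kernel: each truncation level pins the EXACT valuation of the previous residual
(`KoblitzKatzTruncationAtTwo 1` ⇒ `E2CongruenceC6C4AtTwoExact`, given that `c₄, c₆, Δ` are `2`-adic units — the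
bookkeeping target `UnitInvariantsAtTwo`, true on globally minimal good-ordinary models). -/

namespace Summit.BirchSwinnertonDyer.BirchSwinnertonDyer.Cruxes.RankOneAtTwoBigImageOddLocal.AN57

open WeierstrassCurve

/-- support (bookkeeping): on a globally minimal model with good ORDINARY reduction at `2`, `c₄`, `c₆`, `Δ` are `2`-adic units. -/
def UnitInvariantsAtTwo : Prop :=
  ∀ (W : WeierstrassCurve ℚ) [W.IsElliptic] [W.IsGloballyMinimal],
    W.HasGoodReductionAtPrime 2 → ¬ (2 : ℤ) ∣ W.frobeniusTrace 2 →
      ‖(W.baseChange ℚ_[2]).c₄‖ = 1 ∧ ‖(W.baseChange ℚ_[2]).c₆‖ = 1 ∧ ‖(W.baseChange ℚ_[2]).Δ‖ = 1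

theorem koblitzCoeff_zero (h : 0 % 4 < 4) : koblitzCoeff ⟨0 % 4, h⟩ = 1 := by
  rfl
theorem koblitzCoeff_one (h : 1 % 4 < 4) : koblitzCoeff ⟨1 % 4, h⟩ = 720 := by
  rfl

theorem norm_seven_twenty : ‖(720 : ℚ_[2])‖ = 2⁻¹ ^ 4 := by
  have h45 : ‖((45 : ℤ) : ℚ_[2])‖ = 1 := by
    apply le_antisymm (Padic.norm_int_le_one 45)
    by_contra h
    have h' : ‖((45 : ℤ) : ℚ_[2])‖ < 1 := lt_of_not_ge h
    rw [Padic.norm_intCast_lt_one_iff] at h'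
    omega
  have h16 : ‖((2 : ℕ) : ℚ_[2]) ^ 4‖ = 2⁻¹ ^ 4 := by
    rw [Padic.norm_p_pow]; norm_num
  have : (720 : ℚ_[2]) = ((2 : ℕ) : ℚ_[2]) ^ 4 * ((45 : ℤ) : ℚ_[2]) := by push_cast; norm_num
  rw [this, norm_mul, h16, h45, mul_one]

/-- The ultrametric step: `‖c₄³·A + 720·c₆·Δ‖ ≤ 2⁻⁵` with `c₄, c₆, Δ` units forces `‖A‖ = 2⁻⁴`. -/
theorem norm_eq_of_truncation_one {A c4 c6 D : ℚ_[2]} (h4 : ‖c4‖ = 1) (h6 : ‖c6‖ = 1) (hD : ‖D‖ = 1)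
    (h : ‖c4 ^ 3 * A + 720 * c6 * D‖ ≤ 2⁻¹ ^ 5) : ‖A‖ = 2⁻¹ ^ 4 := by
  have hT : ‖(720 : ℚ_[2]) * c6 * D‖ = 2⁻¹ ^ 4 := by
    rw [norm_mul, norm_mul, norm_seven_twenty, h6, hD]; ring
  have hS : ‖c4 ^ 3 * A + 720 * c6 * D‖ < ‖-(720 * c6 * D)‖ := by
    rw [norm_neg, hT]; exact lt_of_le_of_lt h (by norm_num)
  have key : ‖(c4 ^ 3 * A + 720 * c6 * D) + -(720 * c6 * D)‖ =
      max ‖c4 ^ 3 * A + 720 * c6 * D‖ ‖-(720 * c6 * D)‖ := Padic.add_eq_max_of_ne (ne_of_lt hS)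
  have hsimp : (c4 ^ 3 * A + 720 * c6 * D) + -(720 * c6 * D) = c4 ^ 3 * A := by ring
  rw [hsimp, max_eq_right (le_of_lt hS), norm_neg, hT, norm_mul, norm_pow, h4, one_pow, one_mul] at key
  exact key

/-- KERNEL: truncation level `k = 1` of the Koblitz–Katz schema implies the EXACT valuation `4` of `E₂·c₄ + c₆`. -/
theorem e2CongruenceExact_of_truncation_one (hU : UnitInvariantsAtTwo) (h1 : KoblitzKatzTruncationAtTwo 1) :
    E2CongruenceC6C4AtTwoExact := by
  intro W _ _ hg ho Sq c hp
  obtain ⟨h4, h6, hD⟩ := hU W hg ho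
  have h := h1 W hg ho Sq c hp
  simp only [Fin.val_one, Finset.sum_range_succ, Finset.sum_range_zero, zero_add, koblitzCoeff_zero,
    koblitzCoeff_one, Int.cast_one, one_mul, pow_zero, mul_one, pow_one] at h
  norm_num at h
  -- `h : ‖eTwo W c * c₄ ^ 4 + c₆ * (c₄ ^ 3 + 720 * Δ)‖ ≤ 1/32` (up to normalisation)
  have hre : eTwo W c * (W.baseChange ℚ_[2]).c₄ ^ 4 +
      (W.baseChange ℚ_[2]).c₆ * ((W.baseChange ℚ_[2]).c₄ ^ 3 + 720 * (W.baseChange ℚ_[2]).Δ)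
      = (W.baseChange ℚ_[2]).c₄ ^ 3 * (eTwo W c * (W.baseChange ℚ_[2]).c₄ + (W.baseChange ℚ_[2]).c₆)
        + 720 * (W.baseChange ℚ_[2]).c₆ * (W.baseChange ℚ_[2]).Δ := by ring
  refine norm_eq_of_truncation_one h4 h6 hD ?_
  rw [← hre]
  have e : (2⁻¹ : ℝ) ^ 5 = 1 / 32 := by norm_num
  rw [e]
  convert h using 2

end Summit.BirchSwinnertonDyer.BirchSwinnertonDyer.Cruxes.RankOneAtTwoBigImageOddLocal.AN57

/-! ## The bookkeeping target `UnitInvariantsAtTwo` is a THEOREM of the tree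
(`odd_a₁_of_hasGoodReductionAtPrime_two_of_odd_frobeniusTrace_two` — ordinary at `2` ⇒ `a₁` odd ⇒ `c₄`, `c₆` odd;
`not_hasGoodReductionAtPrime_of_dvd_minimalDiscriminantInt` — good at `2` ⇒ `2 ∤ Δ_min`), hence the kernel implication
`KoblitzKatzTruncationAtTwo 1 → E2CongruenceC6C4AtTwoExact` is unconditional. -/

namespace Summit.BirchSwinnertonDyer.BirchSwinnertonDyer.Cruxes.RankOneAtTwoBigImageOddLocal.AN57

open WeierstrassCurve Literature.NumberTheory.EllipticCurves

theorem norm_intCast_eq_one_of_not_two_dvd {z : ℤ} (hz : ¬ (2 : ℤ) ∣ z) : ‖(z : ℚ_[2])‖ = 1 := by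
  apply le_antisymm (Padic.norm_int_le_one z)
  by_contra h
  have h' : ‖(z : ℚ_[2])‖ < 1 := lt_of_not_ge h
  rw [Padic.norm_intCast_lt_one_iff] at h'
  exact hz (by exact_mod_cast h')

theorem not_two_dvd_of_odd {z : ℤ} (hz : Odd z) : ¬ (2 : ℤ) ∣ z :=
  fun h => (Int.not_even_iff_odd.mpr hz) (even_iff_two_dvd.mpr h)

/-- `a₁` odd ⇒ `c₄ = b₂² − 24 b₄` odd (`b₂ = a₁² + 4a₂`). -/
theorem odd_c₄_of_odd_a₁ (M : WeierstrassCurve ℤ) (h : Odd M.a₁) : Odd M.c₄ := by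
  obtain ⟨k, hk⟩ := h
  refine ⟨2 * (2 * k ^ 2 + 2 * k + 2 * M.a₂) ^ 2 + 2 * (2 * k ^ 2 + 2 * k + 2 * M.a₂) - 24 * M.a₄
    - 12 * (2 * k + 1) * M.a₃, ?_⟩
  simp only [WeierstrassCurve.c₄, WeierstrassCurve.b₂, WeierstrassCurve.b₄, hk]
  ring

/-- `a₁` odd ⇒ `c₆ = −b₂³ + 36 b₂ b₄ − 216 b₆` odd. -/
theorem odd_c₆_of_odd_a₁ (M : WeierstrassCurve ℤ) (h : Odd M.a₁) : Odd M.c₆ := by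
  obtain ⟨k, hk⟩ := h
  refine ⟨-4 * (2 * k ^ 2 + 2 * k + 2 * M.a₂) ^ 3 - 6 * (2 * k ^ 2 + 2 * k + 2 * M.a₂) ^ 2
    - 3 * (2 * k ^ 2 + 2 * k + 2 * M.a₂) - 1
    + 18 * (2 * (2 * k ^ 2 + 2 * k + 2 * M.a₂) + 1) * (2 * M.a₄ + (2 * k + 1) * M.a₃)
    - 108 * (M.a₃ ^ 2 + 4 * M.a₆), ?_⟩
  simp only [WeierstrassCurve.c₆, WeierstrassCurve.b₂, WeierstrassCurve.b₄, WeierstrassCurve.b₆, hk]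
  ring

theorem baseChange_two_c₄_eq (W : WeierstrassCurve ℚ) [W.IsGloballyMinimal] :
    (W.baseChange ℚ_[2]).c₄ = ((integralModelInt W).c₄ : ℚ_[2]) := by
  have h := (integralModelInt W).map_c₄ (Int.castRingHom ℚ)
  rw [map_integralModelInt, eq_intCast] at h
  rw [baseChange, map_c₄, eq_ratCast, h, Rat.cast_intCast]

theorem baseChange_two_c₆_eq (W : WeierstrassCurve ℚ) [W.IsGloballyMinimal] :
    (W.baseChange ℚ_[2]).c₆ = ((integralModelInt W).c₆ : ℚ_[2]) := by
  have h := (integralModelInt W).map_c₆ (Int.castRingHom ℚ)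
  rw [map_integralModelInt, eq_intCast] at h
  rw [baseChange, map_c₆, eq_ratCast, h, Rat.cast_intCast]

theorem baseChange_two_Δ_eq (W : WeierstrassCurve ℚ) [W.IsGloballyMinimal] :
    (W.baseChange ℚ_[2]).Δ = (minimalDiscriminantInt W : ℚ_[2]) := by
  rw [baseChange, map_Δ, eq_ratCast, ← cast_minimalDiscriminantInt, Rat.cast_intCast]

/-- **`UnitInvariantsAtTwo` holds**: on a globally minimal model with good ordinary reduction at `2`,
`c₄`, `c₆`, `Δ` are `2`-adic units. -/
theorem unitInvariantsAtTwo_holds : UnitInvariantsAtTwo := by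
  intro W _ _ hg ho
  have hodd : Odd (W.frobeniusTrace 2) := by
    rcases Int.even_or_odd (W.frobeniusTrace 2) with he | hodd
    · exact absurd (even_iff_two_dvd.mp he) ho
    · exact hodd
  have ha₁ : Odd (integralModelInt W).a₁ :=
    odd_a₁_of_hasGoodReductionAtPrime_two_of_odd_frobeniusTrace_two W hg hodd
  have hΔ : ¬ (2 : ℤ) ∣ minimalDiscriminantInt W := fun h =>
    WeierstrassCurve.not_hasGoodReductionAtPrime_of_dvd_minimalDiscriminantInt W 2 (by exact_mod_cast h) hg
  refine ⟨?_, ?_, ?_⟩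
  · rw [baseChange_two_c₄_eq]
    exact norm_intCast_eq_one_of_not_two_dvd (not_two_dvd_of_odd (odd_c₄_of_odd_a₁ _ ha₁))
  · rw [baseChange_two_c₆_eq]
    exact norm_intCast_eq_one_of_not_two_dvd (not_two_dvd_of_odd (odd_c₆_of_odd_a₁ _ ha₁))
  · rw [baseChange_two_Δ_eq]
    exact norm_intCast_eq_one_of_not_two_dvd hΔ

/-- KERNEL, unconditional: truncation level `1` of the Koblitz–Katz schema ⇒ `v₂(E₂·c₄ + c₆) = 4` exactly. -/
theorem e2CongruenceExact_of_truncation_one' (h1 : KoblitzKatzTruncationAtTwo 1) : E2CongruenceC6C4AtTwoExact :=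
  e2CongruenceExact_of_truncation_one unitInvariantsAtTwo_holds h1

end Summit.BirchSwinnertonDyer.BirchSwinnertonDyer.Cruxes.RankOneAtTwoBigImageOddLocal.AN57

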